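import Summits.BirchSwinnertonDyer.BirchSwinnertonDyer.Theorems.PrintX11aUpperNonSurjFiveMultTeichDefs

/-!
# Sinnott ceiling — typed statements (ideator bsd-idea-17 gen 4; memo `SINNOTT-CEILING.md`)

Combinatorial vocabulary for the «automatic vs transcendental» dichotomy of the cusp labelling
`Λ_χ(v/pⁿ) = χ{1/p → v/pⁿ}` of a type-II character `χ` of `Γ₀(pM)`:

* `TreeLabelling p F` — labellings of the rooted `p`-ary tree (a vertex of level `n` = a word of length `n`
  over `Fin p` = the base-`p` digits of a numerator `v mod pⁿ`, least significant first);
* `SameConeType`, `IsTreeAutomatic` — finitely many cone types (⟺ finite `p`-kernel ⟺, by Christol and the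
  Lucas change of basis, the mod-`p` Amice transform of the attached measure is ALGEBRAIC over `𝔽_p(T)`);
* `IsTypeII χ`, `IsCuspLabelling χ L` — `L` is the `χ`-labelling of the cusp tree (`γ(1/p) = v/pⁿ ↦ χ γ`,
  through `MultTeich.numEntry/denEntry`);
* `ConjectureA M p` — a type-II character with an automatic cusp labelling kills `Γ₁(pM)` (is Eisenstein):
  «mod-`p` Mazur–Tate towers of non-Eisenstein systems are transcendental».  OPEN; a NO-GO for the GL₁
  (Ferrero–Washington/Sinnott/Lee–Palvannan) transfer on `UpperNonSurjFive` if true.  Nothing here claims it.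
* `isTreeAutomatic_of_level` — sanity: a labelling that depends only on the level (the Eisenstein shape
  `Λ(v/pⁿ) = (n−1)ψ(p)`) is automatic.

HONEST FRAMING: definitions + one trivial lemma; no stub, no skeleton, no claim toward the crux.  BSD is not proved by
any of this; no summit statement is proved by this seat.
References: Sinnott, Invent. Math. 75 (1984) (doi:10.1007/bf01388565); Sinnott, J. reine angew. Math. 382 (1987) (Prop. 1 of
arXiv:0903.4350); Anglès, Acta Arith. 134 (2008) (arXiv:0709.2838); Allouche–Shallit (2003) Thm 6.6.2, Thm 12.2.5 (Christol).
-/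

noncomputable section

open scoped Classical MatrixGroups
open CongruenceSubgroup

set_option linter.dupNamespace false

namespace Summit.BirchSwinnertonDyer.BirchSwinnertonDyer.Cruxes.UpperNonSurjFive.SinnottCeiling

/-- A labelling of the rooted `p`-ary tree with values in `F`: level `n`, word of length `n` over `Fin p`. -/
abbrev TreeLabelling (p : ℕ) (F : Type*) := (n : ℕ) → (Fin n → Fin p) → F

variable {p : ℕ} {F : Type*}

/-- Two vertices have the same CONE TYPE when the label differences along all common extensions agree. -/
def SameConeType [AddGroup F] (L : TreeLabelling p F) {n n' : ℕ} (w : Fin n → Fin p) (w' : Fin n' → Fin p) :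
    Prop :=
  ∀ m (u : Fin m → Fin p), L (n + m) (Fin.append w u) - L n w = L (n' + m) (Fin.append w' u) - L n' w'

/-- AUTOMATIC labelling: finitely many cone types (a finite set of vertices represents every cone type). -/
def IsTreeAutomatic [AddGroup F] (L : TreeLabelling p F) : Prop :=
  ∃ s : Finset (Σ n, Fin n → Fin p), ∀ n (w : Fin n → Fin p), ∃ v ∈ s, SameConeType L w v.2

/-- The numerator encoded by a word (base-`p` digits, least significant first). -/
def wordVal {n : ℕ} (w : Fin n → Fin p) : ℕ := ∑ i : Fin n, (w i : ℕ) * p ^ (i : ℕ)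

/-- Type II: `χ` kills every element of trace `±2` (every ± parabolic), i.e. `χ ∈ H¹(X₀(N); ·)`. -/
def IsTypeII {N : ℕ} {G : Type*} [Group G] (χ : Gamma0 N →* G) : Prop :=
  ∀ γ : Gamma0 N, ((γ : SL(2, ℤ)) 0 0 + (γ : SL(2, ℤ)) 1 1 = 2 ∨ (γ : SL(2, ℤ)) 0 0 + (γ : SL(2, ℤ)) 1 1 = -2) →
    χ γ = 1

/-- `L` is the `χ`-labelling of the cusp tree of `Γ₀(N)` at `p`: whenever `γ(1/p) = v/pⁿ` ON THE NOSE
(`denEntry = pⁿ`, `numEntry ≡ v (mod pⁿ)`, `n ≥ 1`), the label of the word of `v` is `χ γ` (written additively). -/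
def IsCuspLabelling {N : ℕ} (p : ℕ) (χ : Gamma0 N →* Multiplicative (ZMod p)) (L : TreeLabelling p (ZMod p)) :
    Prop :=
  ∀ (n : ℕ) (w : Fin n → Fin p) (γ : Gamma0 N), 1 ≤ n →
    MultTeich.denEntry p γ = (p : ℤ) ^ n →
    (MultTeich.numEntry p γ : ZMod (p ^ n)) = (wordVal w : ZMod (p ^ n)) →
    L n w = Multiplicative.toAdd (χ γ)

/-- **Conjecture A** (transcendence of mod-`p` Mazur–Tate towers; OPEN, nothing here claims it): at level `pM`,
`p ∤ M`, a type-II character `χ : Γ₀(pM) → 𝔽_p` whose cusp labelling is automatic kills `Γ₁(pM)`. -/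
def ConjectureA (M p : ℕ) : Prop :=
  ∀ (χ : Gamma0 (p * M) →* Multiplicative (ZMod p)) (L : TreeLabelling p (ZMod p)),
    IsTypeII χ → IsCuspLabelling p χ L → IsTreeAutomatic L →
      ∀ γ : Gamma0 (p * M), γ ∈ Gamma1' (p * M) → χ γ = 1

/-- Sanity (the Eisenstein shape): a labelling depending only on the level through an additive function of the
level is automatic — every vertex has the cone type of the root. -/
theorem isTreeAutomatic_of_level [AddCommGroup F] (c : F) (L : TreeLabelling p F)
    (hL : ∀ n (w : Fin n → Fin p), L n w = n • c) : IsTreeAutomatic L := by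
  classical
  refine ⟨{⟨0, Fin.elim0⟩}, fun n w => ⟨⟨0, Fin.elim0⟩, by simp, ?_⟩⟩
  intro m u
  simp only [hL, zero_add, add_smul, zero_smul]
  abel

end Summit.BirchSwinnertonDyer.BirchSwinnertonDyer.Cruxes.UpperNonSurjFive.SinnottCeiling

end
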